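import Summits.RiemannHypothesis.RiemannHypothesis.Theorems.SoloInformedSeparatedZerosLaw
import HarnessLib

/-!
# Separated zeros near every height give the double-exponential law (solo-informed T67)

The conditional half of the lower size law for Weil's form, as a kernel theorem. Two steps:

* `exists_large_value_below_exp_height` — the SPECTRAL CEILING made explicit (T41
  `weilQuadratic_re_ge_ceiling` with Stirling for `Re ψ(¼ + iH/2)` on both sides and
  `ceilingConst_le`): an absolute `C₀ > 0` such that every unit test `g` on `[-a, a]`, `a ≥ 1`,
  with `Re Q(g) ≤ 1` has `|ĝ(½ + it₀)|² > exp(−C₀ a e^{a})` at some `|t₀| < exp(C₀ a e^{a})`.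
* `weilQuadratic_re_ge_of_zeros_near_every_height` — under RH, with the same kind of constant:
  if around EVERY point `t` of `(−e^{C₀ae^{a}}, e^{C₀ae^{a}})` there are `≥ K` ordinates `γ ≠ 0`
  of critical zeros within distance `V`, pairwise `≥ d` apart, where
  `2 e^{3Va} √(2a) e^{C₀ae^{a}} ≤ 2^K`, then every unit test `g` on `[-a, a]` has
  `Re Q(g) ≥ min(1, (e^{−C₀ae^{a}}/(4K))² (d/(4V))^{2(K−1)})`.
  With `V = e^{O(a)}`, `d = e^{−V}`, `K ≍ a e^{a} + aV` (the hypothesis "(AC*)": separated zeros at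
  density `log V` in all short windows, plus the symmetry `γ ↦ −γ`) the right side is
  `exp(−e^{O(a)})`: the DOUBLE-exponential lower law `log log(1/ε(a)) = O(a)`, matching the upper
  law `ε(a) ≤ C exp(−c e^{2a})` in shape; with only Selberg's dyadic windows (`V ≍` height) it is
  the triple-exponential bound of T62.

References: E. Bombieri, Rend. Mat. Acc. Lincei (9) 11 (2000) §4 Lemma 3, (4.3) (key
`Bombieri2000Weil`) for the ceiling; the statements are new. [new]
-/

noncomputable section

open Complex Set MeasureTheory
open Literature.NumberTheory.LFunctions Literature.Analysis.SpecialFunctions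
open scoped Real

namespace Summit.RiemannHypothesis.RiemannHypothesis.Theorems

/-- Two-sided Stirling on the quarter line: `|Re ψ(¼ + iH/2) − log(1 + |H|/2)| ≤ C`.
[cite: Bombieri2000Weil, §4 (4.3)] -/
theorem exists_abs_reDigammaQuarter_sub_log_le :
    ∃ C : ℝ, 0 ≤ C ∧ ∀ H : ℝ, |reDigammaQuarter H - Real.log (1 + |H| / 2)| ≤ C := by
  obtain ⟨C, hC⟩ :=
    Literature.Analysis.SpecialFunctions.Complex.exists_norm_digamma_sub_log_le_of_pos
      (a := 1 / 4) (by norm_num)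
  refine ⟨C, (norm_nonneg _).trans (hC 0), fun H ↦ ?_⟩
  have h := hC (H / 2)
  have e : ((1 / 4 : ℝ) : ℂ) + ((H / 2 : ℝ) : ℂ) * I = 1 / 4 + (H : ℂ) / 2 * I := by
    push_cast; ring
  rw [e, abs_div, abs_two] at h
  have hre := (Complex.abs_re_le_norm (digamma (1 / 4 + (H : ℂ) / 2 * I) -
    (Real.log (1 + |H| / 2) : ℂ))).trans h
  rw [Complex.sub_re, Complex.ofReal_re] at hre
  simpa [reDigammaQuarter] using hre

set_option maxHeartbeats 400000 in
/-- **The spectral ceiling, explicit.** There is an absolute `C₀ > 0` such that every unit test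
`g` on `[-a, a]`, `a ≥ 1`, with `Re Q(g) ≤ 1` has `|ĝ(½ + it₀)|² > exp(−C₀ a e^{a})` at some
`|t₀| < exp(C₀ a e^{a})`. [cite: Bombieri2000Weil, §4 Lemma 3] -/
theorem exists_large_value_below_exp_height :
    ∃ C₀ : ℝ, 0 < C₀ ∧ ∀ a : ℝ, 1 ≤ a → ∀ g : ℝ → ℂ, IsWeilTest g → tsupport g ⊆ Icc (-a) a →
      ∫ t, ‖g t‖ ^ 2 = (1 : ℝ) → (weilQuadratic g).re ≤ 1 →
        ∃ t₀ : ℝ, |t₀| < Real.exp (C₀ * a * Real.exp a) ∧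
          Real.exp (-(C₀ * a * Real.exp a)) < ‖weilMellin g (1 / 2 + t₀ * I)‖ ^ 2 := by
  obtain ⟨C, hC0, hC⟩ := exists_abs_reDigammaQuarter_sub_log_le
  refine ⟨30 + 6 * C, by linarith, fun a ha g hg hsupp hnorm hQ ↦ ?_⟩
  have ha0 : 0 < a := by linarith
  have hea : 1 ≤ Real.exp a := by have := Real.add_one_le_exp a; linarith
  have hae1 : 1 ≤ a * Real.exp a := by
    have := mul_le_mul ha hea zero_le_one ha0.le
    linarith
  -- the explicit scale `B`
  obtain ⟨B, hB⟩ : ∃ B : ℝ, B = 9 * a * Real.exp a + 4 + C := ⟨_, rfl⟩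
  have hL : ceilingConst a ≤ 2 + 9 * a * Real.exp a := by
    have h1 := ceilingConst_le ha0
    have h2 : Real.log π ≤ 2 := by
      rw [Real.log_le_iff_le_exp Real.pi_pos]
      have h := Real.add_one_le_exp (1 : ℝ)
      have e : Real.exp 2 = Real.exp 1 * Real.exp 1 := by rw [← Real.exp_add]; norm_num
      rw [e]
      nlinarith [Real.pi_le_four]
    have h3 : Real.exp a ≤ a * Real.exp a := by nlinarith [Real.exp_pos a]
    linarith
  have hB0 : 0 ≤ B := by rw [hB]; linarith
  have hLB : ceilingConst a + 2 + C ≤ B := by rw [hB]; linarith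
  obtain ⟨E, hE⟩ : ∃ E : ℝ, E = Real.exp (ceilingConst a + 2 + C) := ⟨_, rfl⟩
  have hE0 : 0 < E := by rw [hE]; exact Real.exp_pos _
  have hEB : E ≤ Real.exp B := by rw [hE]; exact Real.exp_le_exp.2 hLB
  have h1B : 1 ≤ Real.exp B := by have := Real.add_one_le_exp B; linarith
  obtain ⟨H, hH⟩ : ∃ H : ℝ, H = 2 * E := ⟨_, rfl⟩
  have hH0 : 0 < H := by rw [hH]; positivity
  have hlogH : Real.log (1 + |H| / 2) = Real.log (1 + E) := by
    rw [abs_of_pos hH0, hH]; ring_nf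
  -- `W(H) ≥ L + 2`, `W(H) ≤ E + C`, `w₀ ≥ -C`
  have hWlo : ceilingConst a + 2 ≤ reDigammaQuarter H := by
    have h1 := (abs_le.1 (hC H)).1
    have h2 : ceilingConst a + 2 + C ≤ Real.log (1 + E) := by
      rw [Real.le_log_iff_exp_le (by positivity), ← hE]
      linarith
    rw [hlogH] at h1
    linarith
  have hWhi : reDigammaQuarter H ≤ E + C := by
    have h1 := (abs_le.1 (hC H)).2
    have h2 : Real.log (1 + E) ≤ E := by
      have := Real.log_le_sub_one_of_pos (by positivity : (0 : ℝ) < 1 + E)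
      linarith
    rw [hlogH] at h1
    linarith
  have hw₀ : -C ≤ reDigammaQuarter 0 := by
    have h1 := (abs_le.1 (hC 0)).1
    have e : Real.log (1 + |(0 : ℝ)| / 2) = 0 := by simp
    rw [e] at h1
    linarith
  have hw₀W : reDigammaQuarter 0 ≤ reDigammaQuarter H := reDigammaQuarter_zero_le H
  obtain ⟨D, hD⟩ : ∃ D : ℝ, D = reDigammaQuarter H - reDigammaQuarter 0 + 1 := ⟨_, rfl⟩
  have hD0 : 0 < D := by rw [hD]; linarith
  have hDle : D ≤ (2 * C + 2) * Real.exp B := by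
    have h2 : (2 * C + 1) * 1 ≤ (2 * C + 1) * Real.exp B :=
      mul_le_mul_of_nonneg_left h1B (by linarith)
    rw [hD]
    linarith
  -- mass below `H` from the ceiling inequality
  have hceil := weilQuadratic_re_ge_ceiling hg hsupp H
  rw [hnorm, mul_one, abs_of_pos hH0] at hceil
  obtain ⟨μ, hμ⟩ :
      ∃ μ : ℝ, μ = ∫ t in Ioo (-H) H, ‖weilMellin g (1 / 2 + t * I)‖ ^ 2 := ⟨_, rfl⟩
  rw [← hμ] at hceil
  have hmass : 2 * π ≤ D * μ := by
    have hμ0 : 0 ≤ μ := by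
      rw [hμ]; exact setIntegral_nonneg measurableSet_Ioo fun t _ ↦ by positivity
    have h1 : 1 ≤ (reDigammaQuarter H - reDigammaQuarter 0) * (1 / (2 * π) * μ) := by
      linarith
    have h2 : (reDigammaQuarter H - reDigammaQuarter 0) * (1 / (2 * π) * μ) ≤
        D * (1 / (2 * π) * μ) := by
      apply mul_le_mul_of_nonneg_right _ (by positivity)
      rw [hD]; linarith
    have e : D * (1 / (2 * π) * μ) = D * μ / (2 * π) := by ring
    have h3 := h1.trans h2
    rw [e, le_div_iff₀ (by positivity)] at h3
    linarith
  -- mean value on `(-H, H)`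
  obtain ⟨t₀, ht₀, hval⟩ :
      ∃ t₀ : ℝ, |t₀| < H ∧ π / (2 * H * D) < ‖weilMellin g (1 / 2 + t₀ * I)‖ ^ 2 := by
    by_contra hcon
    push Not at hcon
    have hfi : IntegrableOn (fun t : ℝ ↦ ‖weilMellin g (1 / 2 + t * I)‖ ^ 2) (Ioo (-H) H) :=
      (integrable_norm_sq_weilMellin_half_line hg).integrableOn
    have hle : μ ≤ ∫ _t in Ioo (-H) H, π / (2 * H * D) := by
      rw [hμ]
      refine setIntegral_mono_on hfi (integrableOn_const (by simp [Real.volume_Ioo]))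
        measurableSet_Ioo fun t ht ↦ ?_
      exact hcon t (abs_lt.2 ⟨ht.1, ht.2⟩)
    have hconst : ∫ _t in Ioo (-H) H, π / (2 * H * D) = π / D := by
      rw [setIntegral_const, Real.volume_real_Ioo_of_le (by linarith), smul_eq_mul]
      field_simp
      ring
    rw [hconst] at hle
    have h4 : D * (π / D) = π := by field_simp
    have h5 := mul_le_mul_of_nonneg_left hle hD0.le
    rw [h4] at h5
    linarith [Real.pi_pos]
  refine ⟨t₀, ?_, lt_of_le_of_lt ?_ hval⟩
  · -- `H = 2E ≤ e · e^B ≤ exp(C₀ a e^a)`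
    calc |t₀| < H := ht₀
      _ ≤ Real.exp (B + 1) := by
          rw [hH, Real.exp_add]
          have : (2 : ℝ) ≤ Real.exp 1 := by have := Real.add_one_le_exp (1 : ℝ); linarith
          nlinarith [Real.exp_pos B]
      _ ≤ Real.exp ((30 + 6 * C) * a * Real.exp a) := by
          rw [Real.exp_le_exp, hB]
          have : (21 + 6 * C) * 1 ≤ (21 + 6 * C) * (a * Real.exp a) :=
            mul_le_mul_of_nonneg_left hae1 (by linarith)
          linarith
  · -- `exp(-C₀ a e^a) ≤ π / (2 H D)`
    rw [le_div_iff₀ (by positivity)]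
    have h1 : 2 * H * D ≤ 8 * (C + 1) * (Real.exp B * Real.exp B) := by
      rw [hH]
      have := mul_le_mul hEB hDle hD0.le (Real.exp_pos B).le
      nlinarith [this]
    have h3 : 2 * B + 3 * (C + 1) ≤ (30 + 6 * C) * a * Real.exp a := by
      rw [hB]
      have : (12 + 6 * C) * 1 ≤ (12 + 6 * C) * (a * Real.exp a) :=
        mul_le_mul_of_nonneg_left hae1 (by linarith)
      linarith
    have h4 : Real.exp (-((30 + 6 * C) * a * Real.exp a)) * (Real.exp B * Real.exp B) ≤
        Real.exp (-(3 * (C + 1))) := by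
      rw [← Real.exp_add, ← Real.exp_add, Real.exp_le_exp]
      linarith
    have h5 : Real.exp (-(3 * (C + 1))) * (8 * (C + 1)) ≤ π := by
      have h6 := Real.add_one_le_exp (3 * (C + 1))
      have h7 : Real.exp (3 * (C + 1)) * 3 ≤ Real.exp (3 * (C + 1)) * π :=
        mul_le_mul_of_nonneg_left Real.pi_gt_three.le (Real.exp_pos _).le
      rw [Real.exp_neg, inv_mul_le_iff₀ (Real.exp_pos _)]
      linarith
    calc Real.exp (-((30 + 6 * C) * a * Real.exp a)) * (2 * H * D)
        ≤ Real.exp (-((30 + 6 * C) * a * Real.exp a)) *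
            (8 * (C + 1) * (Real.exp B * Real.exp B)) :=
          mul_le_mul_of_nonneg_left h1 (Real.exp_pos _).le
      _ = Real.exp (-((30 + 6 * C) * a * Real.exp a)) * (Real.exp B * Real.exp B) *
            (8 * (C + 1)) := by ring
      _ ≤ Real.exp (-(3 * (C + 1))) * (8 * (C + 1)) :=
          mul_le_mul_of_nonneg_right h4 (by linarith)
      _ ≤ π := h5

/-- **Separated zeros near every height give the double-exponential law (RH).** With an absolute
`C₀ > 0`: if every point of `(−e^{C₀ae^{a}}, e^{C₀ae^{a}})` has `≥ K` ordinates `γ ≠ 0` of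
critical zeros within `V`, pairwise `≥ d` apart, and `2e^{3Va}√(2a)e^{C₀ae^{a}} ≤ 2^K`, then every
unit test on `[-a, a]` has `Re Q ≥ min(1, (e^{−C₀ae^{a}}/(4K))² (d/(4V))^{2(K−1)})`. [new] -/
theorem weilQuadratic_re_ge_of_zeros_near_every_height (hRH : RiemannHypothesis) :
    ∃ C₀ : ℝ, 0 < C₀ ∧ ∀ a : ℝ, 1 ≤ a → ∀ V d : ℝ, 0 < V → 0 < d → ∀ K : ℕ,
      2 * Real.exp (3 * V * a) * Real.sqrt (2 * a) * Real.exp (C₀ * a * Real.exp a) ≤ 2 ^ K →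
      (∀ t : ℝ, |t| < Real.exp (C₀ * a * Real.exp a) → ∃ S : Finset ℝ,
          (∀ γ ∈ S, γ ≠ 0 ∧ |γ - t| ≤ V ∧ riemannZeta (1 / 2 + γ * I) = 0) ∧
          (∀ γ ∈ S, ∀ γ' ∈ S, γ ≠ γ' → d ≤ |γ - γ'|) ∧ K ≤ S.card) →
      ∀ g : ℝ → ℂ, IsWeilTest g → tsupport g ⊆ Icc (-a) a → ∫ t, ‖g t‖ ^ 2 = (1 : ℝ) →
        min 1 ((Real.exp (-(C₀ * a * Real.exp a)) / (4 * K)) ^ 2 *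
          ((d / (4 * V)) ^ (K - 1)) ^ 2) ≤ (weilQuadratic g).re := by
  obtain ⟨C, hC, hB⟩ := exists_large_value_below_exp_height
  refine ⟨2 * C, by positivity, fun a ha V d hV hd K hK hwin g hg hsupp hnorm ↦ ?_⟩
  rcases lt_or_ge 1 (weilQuadratic g).re with hQ1 | hQ1
  · exact (min_le_left _ _).trans hQ1.le
  refine (min_le_right _ _).trans ?_
  have ha0 : 0 < a := by linarith
  obtain ⟨t₀, ht₀, hval⟩ := hB a ha g hg hsupp hnorm hQ1
  have hae : 0 < a * Real.exp a := by positivity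
  have hH : Real.exp (C * a * Real.exp a) ≤ Real.exp (2 * C * a * Real.exp a) :=
    Real.exp_le_exp.2 (by nlinarith)
  obtain ⟨S, hS, hsep, hKS⟩ := hwin t₀ (ht₀.trans_le hH)
  obtain ⟨S', hS'S, hcard⟩ := Finset.exists_subset_card_eq hKS
  -- the value `m = exp(-2C a e^a)`
  obtain ⟨m, hm⟩ : ∃ m : ℝ, m = Real.exp (-(2 * C * a * Real.exp a)) := ⟨_, rfl⟩
  have hm0 : 0 < m := by rw [hm]; exact Real.exp_pos _
  have hmsq : m ^ 2 ≤ Real.exp (-(C * a * Real.exp a)) := by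
    rw [hm, ← Real.exp_nat_mul, Real.exp_le_exp]; push_cast; nlinarith
  have hmle : m ≤ ‖weilMellin g (1 / 2 + t₀ * I)‖ := by
    by_contra h
    push Not at h
    have := pow_lt_pow_left₀ h (norm_nonneg _) two_ne_zero
    linarith
  -- the growth hypothesis of T66
  have hgrowth : Real.exp (3 * V * a) * Real.sqrt (2 * a) / 2 ^ S'.card ≤ m / 2 := by
    rw [hcard, div_le_div_iff₀ (by positivity) (by norm_num : (0 : ℝ) < 2)]
    have e1 : Real.exp (2 * C * a * Real.exp a) * m = 1 := by
      rw [hm, ← Real.exp_add, add_neg_cancel, Real.exp_zero]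
    calc Real.exp (3 * V * a) * Real.sqrt (2 * a) * 2
        = 2 * Real.exp (3 * V * a) * Real.sqrt (2 * a) * Real.exp (2 * C * a * Real.exp a)
            * m := by
          calc Real.exp (3 * V * a) * Real.sqrt (2 * a) * 2
              = Real.exp (3 * V * a) * Real.sqrt (2 * a) * 2 *
                  (Real.exp (2 * C * a * Real.exp a) * m) := by rw [e1, mul_one]
            _ = _ := by ring
      _ ≤ 2 ^ K * m := mul_le_mul_of_nonneg_right hK hm0.le
      _ = m * 2 ^ K := mul_comm _ _
  have key := weilQuadratic_re_ge_of_separated_zeros hRH hg ha0 hsupp hnorm hV hd hm0.le hmle S'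
    (fun γ hγ ↦ hS γ (hS'S hγ)) (fun γ hγ γ' hγ' hne ↦ hsep γ (hS'S hγ) γ' (hS'S hγ') hne)
    hgrowth
  rw [hcard] at key
  rw [← hm]
  exact key

end Summit.RiemannHypothesis.RiemannHypothesis.Theorems
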